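import Summits.PneNP.PneNP.Theorems.RootDecompSegregatorSmallSegregators.Negative.Defs

/-!
# K\*\* — proofs 1/6 (`KSS1`)

Proof file 1/6 of the kernel refutation of the route item `RootDecompSegregator.SmallSegregators`
(stmt-PneNP-26297; deciding theorem `Summit.PneNP.PneNP.Theorems.RootDecompSegregatorSmallSegregators_refuted`
in `Theorems/RootDecompSegregatorSmallSegregatorsRefutation.lean`; definitions in `Defs.lean` of this
directory).  Topic: lemmas `ancestorsAvoiding_finite` … `card_Bltot_eq`.

PROVENANCE.  Mathematics and Lean text by the decomp-pnenp cell's lens-1 lineage (work file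
`decomp-pnenp-lens-1/SegregatorPageThreshold.lean`, generations 4–5, v5 sha256 `099856e2…`, brief
`KSS-DoubleButterfly.md`): the dependency cone of its theorem `not_smallSegregators`, extracted verbatim by
the cell critic and split into files of at most 400 lines (docstrings added where missing).  No declaration
here mentions a Theses item; the chain ends in `ancestorRobust_three : AncestorRobust 3 160 12` (last file),
from which the flat refutation file concludes `¬ SmallSegregators` by the kill switch
`not_smallSegregatorsAt_of_ancestorRobust` at `r = 3`, `k = 172`.
-/

namespace Summit.PneNP.PneNP.Theorems.RootDecompSegregatorSmallSegregators.Negative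

open Relation

/-! ### The KILL ROAD for Piece A, typed per page number: depth-robust ⟹ ancestor-robust ⟹ ¬A(r)
K** (header; graph `dbGraph` typed in the next section) delivers `AncestorRobust 3 960 24` DIRECTLY —
ancestor mass, not depth — and then `not_smallSegregators_of_ancestorRobust` below refutes Piece A. -/

/-- K\*\* cone (auxiliary lemma): `ancestorsAvoiding_finite`. -/
theorem ancestorsAvoiding_finite (E : Finset (ℕ × ℕ)) (J : Finset ℕ) (v : ℕ) :
    (ancestorsAvoiding E J v).Finite :=
  (Finset.finite_toSet _).subset (ancestorsAvoiding_subset E J v)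

/-- **Kill switch per page number**: an ancestor-robust `H_r` family refutes `SmallSegregatorsAt r`. -/
theorem not_smallSegregatorsAt_of_ancestorRobust {r c δ : ℕ} (h : AncestorRobust r c δ) :
    ¬ SmallSegregatorsAt r := by
  intro hS
  obtain ⟨N₀, hN₀⟩ := hS (c + δ)
  obtain ⟨N, hN, E, hE, hrob⟩ := h N₀
  obtain ⟨J, hJ, hseg⟩ := hN₀ N hN E hE
  have hc : c * (J.card * ell N) ≤ N :=
    le_trans (Nat.mul_le_mul_right _ (by omega : c ≤ c + δ + 1)) hJ
  obtain ⟨v, hv, hvJ, hlt⟩ := hrob J hc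
  have h1 : (ancestorsAvoiding E J v).ncard ≤ N / (c + δ + 1) := hseg v hv hvJ
  have h2 : δ * (ancestorsAvoiding E J v).ncard ≤ δ * (N / (c + δ + 1)) :=
    Nat.mul_le_mul_left δ h1
  have h3 : δ * (N / (c + δ + 1)) ≤ (c + δ + 1) * (N / (c + δ + 1)) :=
    Nat.mul_le_mul_right _ (by omega)
  have h4 : (c + δ + 1) * (N / (c + δ + 1)) ≤ N := Nat.mul_div_le N (c + δ + 1)
  omega

/-! ### K** — the kill of Piece A at three pages: LAYOUT IN KERNEL, robustness pencil
(brief `decomp-pnenp-lens-1/KSS-DoubleButterfly.md`).  Generic lemma: the push/pop matching of ANY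
stack trace is a pushdown family; the double reflected butterfly executed on one tape (TL, TR) and one
pushdown (S) is therefore an `H_3(10·M·L + 2M)` graph, `dbGraph L`.  Its ancestor-robustness
(`AncestorRobust 3 960 24`, brief §4) is the pencil part; `not_smallSegregators_of_dbRobust` is the hook. -/

open StackOp

/-- The LIFO invariant: arcs go forward, end in the time window of the trace, start at a pending
push or inside the window, have distinct heads, and never cross. -/
theorem lifoArcs_inv : ∀ (ops : List StackOp) (t : ℕ) (st : List ℕ),
    st.Pairwise (· > ·) → (∀ p ∈ st, p < t) →
    (∀ e ∈ lifoArcs ops t st, e.1 < e.2 ∧ t ≤ e.2 ∧ e.2 < t + ops.length ∧ (e.1 ∈ st ∨ t ≤ e.1)) ∧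
    (∀ e₁ ∈ lifoArcs ops t st, ∀ e₂ ∈ lifoArcs ops t st, e₁.2 = e₂.2 → e₁ = e₂) ∧
    (∀ e₁ ∈ lifoArcs ops t st, ∀ e₂ ∈ lifoArcs ops t st,
      e₁.1 < e₂.1 → e₂.1 < e₁.2 → e₂.2 ≤ e₁.2)
  | [], t, st, _, _ => by simp [lifoArcs]
  | push :: ops, t, st, hst, hlt => by
    have hst' : (t :: st).Pairwise (· > ·) := List.pairwise_cons.2 ⟨fun q hq => hlt q hq, hst⟩
    have hlt' : ∀ p ∈ t :: st, p < t + 1 := by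
      intro p hp
      rcases List.mem_cons.1 hp with rfl | hp
      · exact Nat.lt_succ_self _
      · exact Nat.lt_succ_of_lt (hlt p hp)
    obtain ⟨h1, h2, h3⟩ := lifoArcs_inv ops (t + 1) (t :: st) hst' hlt'
    refine ⟨fun e he => ?_, fun e₁ he₁ e₂ he₂ => h2 e₁ he₁ e₂ he₂, fun e₁ he₁ e₂ he₂ => h3 e₁ he₁ e₂ he₂⟩
    obtain ⟨ha, hb, hc, hd⟩ := h1 e he
    refine ⟨ha, by omega, by simp [List.length_cons]; omega, ?_⟩
    rcases hd with hd | hd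
    · rcases List.mem_cons.1 hd with hd | hd
      · right; omega
      · exact Or.inl hd
    · right; omega
  | pop :: ops, t, [], _, _ => by
    obtain ⟨h1, h2, h3⟩ := lifoArcs_inv ops (t + 1) [] List.Pairwise.nil (by simp)
    refine ⟨fun e he => ?_, fun e₁ he₁ e₂ he₂ => h2 e₁ he₁ e₂ he₂, fun e₁ he₁ e₂ he₂ => h3 e₁ he₁ e₂ he₂⟩
    obtain ⟨ha, hb, hc, hd⟩ := h1 e (by simpa [lifoArcs] using he)
    refine ⟨ha, by omega, by simp [List.length_cons]; omega, ?_⟩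
    rcases hd with hd | hd
    · simp at hd
    · right; omega
  | pop :: ops, t, p :: st, hst, hlt => by
    have hp : ∀ q ∈ st, q < p := (List.pairwise_cons.1 hst).1
    have hst' : st.Pairwise (· > ·) := (List.pairwise_cons.1 hst).2
    have hlt' : ∀ q ∈ st, q < t + 1 := fun q hq => Nat.lt_succ_of_lt (hlt q (List.mem_cons_of_mem _ hq))
    have hpt : p < t := hlt p (List.mem_cons_self)
    obtain ⟨h1, h2, h3⟩ := lifoArcs_inv ops (t + 1) st hst' hlt'
    have hmem : ∀ e, e ∈ lifoArcs (pop :: ops) t (p :: st) ↔ e = (p, t) ∨ e ∈ lifoArcs ops (t + 1) st := by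
      intro e; simp [lifoArcs]
    refine ⟨fun e he => ?_, fun e₁ he₁ e₂ he₂ hh => ?_, fun e₁ he₁ e₂ he₂ ha hb => ?_⟩
    · rcases (hmem e).1 he with rfl | he
      · refine ⟨hpt, le_rfl, by simp [List.length_cons], Or.inl (List.mem_cons_self)⟩
      · obtain ⟨ha, hb, hc, hd⟩ := h1 e he
        refine ⟨ha, by omega, by simp [List.length_cons]; omega, ?_⟩
        rcases hd with hd | hd
        · exact Or.inl (List.mem_cons_of_mem _ hd)
        · right; omega
    · rcases (hmem e₁).1 he₁ with rfl | he₁ <;> rcases (hmem e₂).1 he₂ with rfl | he₂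
      · rfl
      · obtain ⟨_, hb, _, _⟩ := h1 e₂ he₂; simp at hh; omega
      · obtain ⟨_, hb, _, _⟩ := h1 e₁ he₁; simp at hh; omega
      · exact h2 e₁ he₁ e₂ he₂ hh
    · rcases (hmem e₁).1 he₁ with rfl | he₁ <;> rcases (hmem e₂).1 he₂ with rfl | he₂
      · simp at ha
      · -- e₁ = (p,t), e₂ ∈ R with p < e₂.1 < t : impossible
        obtain ⟨_, _, _, hd⟩ := h1 e₂ he₂
        simp at ha hb
        rcases hd with hd | hd
        · exact absurd (hp _ hd) (by omega)
        · omega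
      · -- e₁ ∈ R, e₂ = (p,t): need t ≤ e₁.2
        obtain ⟨_, hb1, _, _⟩ := h1 e₁ he₁
        simp; omega
      · exact h3 e₁ he₁ e₂ he₂ ha hb
  | skip :: ops, t, st, hst, hlt => by
    obtain ⟨h1, h2, h3⟩ := lifoArcs_inv ops (t + 1) st hst (fun q hq => Nat.lt_succ_of_lt (hlt q hq))
    have hmem : ∀ e, e ∈ lifoArcs (skip :: ops) t st ↔ e ∈ lifoArcs ops (t + 1) st := by
      intro e; simp [lifoArcs]
    refine ⟨fun e he => ?_, fun e₁ he₁ e₂ he₂ => h2 e₁ ((hmem _).1 he₁) e₂ ((hmem _).1 he₂),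
      fun e₁ he₁ e₂ he₂ => h3 e₁ ((hmem _).1 he₁) e₂ ((hmem _).1 he₂)⟩
    obtain ⟨ha, hb, hc, hd⟩ := h1 e ((hmem _).1 he)
    refine ⟨ha, by omega, by simp [List.length_cons]; omega, ?_⟩
    rcases hd with hd | hd
    · exact Or.inl hd
    · right; omega

/-- **Generic layout lemma.** The push/pop arcs of any stack trace form a pushdown family. -/
theorem isPushdownFamily_lifoArcs (ops : List StackOp) : IsPushdownFamily (lifoArcs ops 0 []) := by
  obtain ⟨h1, h2, h3⟩ := lifoArcs_inv ops 0 [] List.Pairwise.nil (by simp)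
  exact ⟨fun e he => (h1 e he).1, h2, h3⟩

/-- K\*\* cone (auxiliary lemma): `lifoArcs_lt_length`. -/
theorem lifoArcs_lt_length (ops : List StackOp) :
    ∀ e ∈ lifoArcs ops 0 [], e.1 < e.2 ∧ e.2 < ops.length := by
  obtain ⟨h1, _, _⟩ := lifoArcs_inv ops 0 [] List.Pairwise.nil (by simp)
  intro e he
  obtain ⟨ha, _, hc, _⟩ := h1 e he
  exact ⟨ha, by simpa using hc⟩

/-- K\*\* cone (auxiliary lemma): `isMultiPushdownGraph_traceGraph`. -/
theorem isMultiPushdownGraph_traceGraph {T : ℕ} {τ₀ τ₁ τ₂ : List StackOp}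
    (h₀ : τ₀.length = T) (h₁ : τ₁.length = T) (h₂ : τ₂.length = T) :
    IsMultiPushdownGraph 3 T (traceGraph T τ₀ τ₁ τ₂) := by
  classical
  let F : Fin 3 → Finset (ℕ × ℕ) := ![lifoArcs τ₀ 0 [], lifoArcs τ₁ 0 [], lifoArcs τ₂ 0 []]
  refine ⟨fun e he => ?_, ⟨F, fun m => ?_, fun e he => ?_⟩⟩
  · simp only [traceGraph, Finset.mem_union, Finset.mem_image, Finset.mem_range] at he
    rcases he with ⟨t, ht, rfl⟩ | (he | he) | he
    · exact ⟨Nat.lt_succ_self t, by omega⟩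
    · have := lifoArcs_lt_length τ₀ e he; omega
    · have := lifoArcs_lt_length τ₁ e he; omega
    · have := lifoArcs_lt_length τ₂ e he; omega
  · fin_cases m <;> exact isPushdownFamily_lifoArcs _
  · simp only [traceGraph, Finset.mem_union, Finset.mem_image, Finset.mem_range] at he
    rcases he with ⟨t, ht, rfl⟩ | (he | he) | he
    · exact Or.inl rfl
    · exact Or.inr ⟨0, he⟩
    · exact Or.inr ⟨1, he⟩
    · exact Or.inr ⟨2, he⟩

/-! ### K** as a TWO-HYPOTHESIS KERNEL REDUCTION (0 sorry): charged path system + counting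
The pencil proof of the brief factors through a machine-independent interface.  A CHARGED `DB(L)` PATH
SYSTEM in a step graph `E` on `[0,T)` assigns to every abstract vertex `(λ, x)` (`λ ≤ 2L`, `x < 2^L`) a
birth step and a finite set of carrier steps such that (path) whenever the birth, the carriers and the
target birth avoid `J`, the birth of `(λ, x)` is a `J`-avoiding ancestor of the birth of each of its two
out-neighbours `(λ+1, x)`, `(λ+1, r_λ x)`, and (charge) every step is birth-or-carrier for at most `κ`
abstract vertices.  `DBCount κ` is the COUNTING LEMMA (pencil (B1)+(B2), pure finite combinatorics of the
reflected butterfly: blocked ≤ κ|J| ≤ M/16 ⟹ some top keeps ≥ (7/8)·M·L good lower vertices, whose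
births are ≥ (7/8)ML/κ distinct avoiding ancestors); `DBLayout κ` says the schedule's step graph
`dbGraph L` carries such a system (κ = 5: verified mechanically for `L ≤ 8` by `kss/dbfly2.py`, pencil in
general).  KERNEL: the two together give `AncestorRobust 3 (160κ) (12κ)` — the budget arithmetic
(`ell (dbT L) ≥ L + 4`, `|J| ≤ M/(16κ)`) and the final inequality are proved here — hence ¬A. -/

/-- K\*\* cone (auxiliary lemma): `dbT_eq`. -/
theorem dbT_eq (L : ℕ) : dbT L = 10 * (2 ^ L * L) + 2 * 2 ^ L := by unfold dbT; ring

/-- K\*\* cone (auxiliary lemma): `ell_dbT_ge`. -/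
theorem ell_dbT_ge {L : ℕ} (hL : 1 ≤ L) : L + 4 ≤ ell (dbT L) := by
  have hML : 2 ^ L ≤ 2 ^ L * L := Nat.le_mul_of_pos_right _ hL
  have hT8 : 2 ^ (L + 3) ≤ dbT L := by
    have e1 : 2 ^ (L + 3) = 8 * 2 ^ L := by rw [pow_add]; ring
    rw [e1, dbT_eq]
    calc 8 * 2 ^ L ≤ 8 * (2 ^ L * L) := Nat.mul_le_mul_left 8 hML
      _ ≤ 10 * (2 ^ L * L) := Nat.mul_le_mul_right _ (by norm_num)
      _ ≤ 10 * (2 ^ L * L) + 2 * 2 ^ L := Nat.le_add_right _ _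
  have hlog : L + 3 ≤ Nat.log 2 (dbT L) := Nat.le_log_of_pow_le (by norm_num) hT8
  unfold ell; omega

section KSSCount

open Finset

/-! #### Transitivity of avoiding ancestry -/

/-- K\*\* cone (auxiliary lemma): `ancestorsAvoiding_trans`. -/
theorem ancestorsAvoiding_trans {E : Finset (ℕ × ℕ)} {J : Finset ℕ} {u v w : ℕ}
    (huv : u ∈ ancestorsAvoiding E J v) (hvw : v ∈ ancestorsAvoiding E J w) :
    u ∈ ancestorsAvoiding E J w :=
  TransGen.trans huv hvw

/-! #### The mirror: block form, range, block preservation, involution, half switching -/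

section Mirror

variable {L lam x : ℕ}

/-- Block form: with `B = 2^(L - lam % L)`, `x = qB + w`, the mirror is `qB + (B - 1 - w)`. -/
theorem dbMirror_eq (L lam x : ℕ) :
    dbMirror L lam x = x / 2 ^ (L - lam % L) * 2 ^ (L - lam % L) +
      (2 ^ (L - lam % L) - 1 - x % 2 ^ (L - lam % L)) := by
  unfold dbMirror
  set B := 2 ^ (L - lam % L) with hB
  have hBpos : 0 < B := by positivity
  have hx : x = x / B * B + x % B := (Nat.div_add_mod' x B).symm
  have hw : x % B < B := Nat.mod_lt _ hBpos
  set s := x / B * B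
  set w := x % B
  omega

/-- K\*\* cone (auxiliary lemma): `dbMirror_div`. -/
theorem dbMirror_div (L lam x : ℕ) :
    dbMirror L lam x / 2 ^ (L - lam % L) = x / 2 ^ (L - lam % L) := by
  rw [dbMirror_eq]
  set B := 2 ^ (L - lam % L) with hB
  have hBpos : 0 < B := by positivity
  have hw : x % B < B := Nat.mod_lt _ hBpos
  rw [show x / B * B + (B - 1 - x % B) = (B - 1 - x % B) + B * (x / B) by ring,
    Nat.add_mul_div_left _ _ hBpos, Nat.div_eq_of_lt (by omega), zero_add]

/-- K\*\* cone (auxiliary lemma): `dbMirror_mod`. -/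
theorem dbMirror_mod (L lam x : ℕ) :
    dbMirror L lam x % 2 ^ (L - lam % L) = 2 ^ (L - lam % L) - 1 - x % 2 ^ (L - lam % L) := by
  rw [dbMirror_eq]
  set B := 2 ^ (L - lam % L) with hB
  have hBpos : 0 < B := by positivity
  have hw : x % B < B := Nat.mod_lt _ hBpos
  rw [show x / B * B + (B - 1 - x % B) = (B - 1 - x % B) + B * (x / B) by ring,
    Nat.add_mul_mod_self_left, Nat.mod_eq_of_lt (by omega)]

/-- K\*\* cone (auxiliary lemma): `dbMirror_dbMirror`. -/
theorem dbMirror_dbMirror (L lam x : ℕ) : dbMirror L lam (dbMirror L lam x) = x := by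
  rw [dbMirror_eq L lam (dbMirror L lam x), dbMirror_div, dbMirror_mod]
  set B := 2 ^ (L - lam % L) with hB
  have hBpos : 0 < B := by positivity
  have hw : x % B < B := Nat.mod_lt _ hBpos
  have hx : x / B * B + x % B = x := Nat.div_add_mod' x B
  omega

/-- K\*\* cone (auxiliary lemma): `dbMirror_lt`. -/
theorem dbMirror_lt (hx : x < 2 ^ L) : dbMirror L lam x < 2 ^ L := by
  rw [dbMirror_eq]
  set k := L - lam % L with hk
  set B := 2 ^ k with hB
  have hBpos : 0 < B := by positivity
  have hkL : k ≤ L := by omega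
  have hM : 2 ^ L = B * 2 ^ (L - k) := by rw [hB, ← pow_add]; congr 1; omega
  have hq : x / B < 2 ^ (L - k) := by
    rw [Nat.div_lt_iff_lt_mul hBpos]; rw [hM] at hx; linarith [hx]
  have hw : x % B < B := Nat.mod_lt _ hBpos
  have h1 : x / B * B + (B - 1 - x % B) < (x / B + 1) * B := by
    rw [add_mul, one_mul]; omega
  calc x / B * B + (B - 1 - x % B) < (x / B + 1) * B := h1
    _ ≤ 2 ^ (L - k) * B := Nat.mul_le_mul_right _ hq
    _ = 2 ^ L := by rw [hM, mul_comm]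

/-- Half switching: when the block size `B = 2H` is at least 2, `x` and its mirror lie in different
`H`-blocks. -/
theorem dbMirror_div_half_ne {H : ℕ} (hH : 2 ^ (L - lam % L) = 2 * H) (hHpos : 0 < H) :
    dbMirror L lam x / H ≠ x / H := by
  rw [dbMirror_eq]
  set B := 2 ^ (L - lam % L) with hB
  have hw : x % B < B := Nat.mod_lt _ (by positivity)
  have hx : x = H * (2 * (x / B)) + x % B := by
    have e : x / B * B = H * (2 * (x / B)) := by
      rw [show (B : ℕ) = 2 * H from hH]; ring
    rw [← e]; exact (Nat.div_add_mod' x B).symm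
  have e1 : x / H = 2 * (x / B) + x % B / H := by
    conv_lhs => rw [hx]
    rw [Nat.mul_add_div hHpos]
  have e2 : (x / B * B + (B - 1 - x % B)) / H = 2 * (x / B) + (B - 1 - x % B) / H := by
    rw [show x / B * B + (B - 1 - x % B) = H * (2 * (x / B)) + (B - 1 - x % B) by
      rw [hH]; ring_nf, Nat.mul_add_div hHpos]
  rw [e1, e2]
  intro h
  have h' : (B - 1 - x % B) / H = x % B / H := by omega
  by_cases hwH : x % B < H
  · rw [Nat.div_eq_of_lt hwH] at h'
    have : H ≤ B - 1 - x % B := by omega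
    have := Nat.div_pos this hHpos
    omega
  · have hwH' : H ≤ x % B := not_lt.mp hwH
    have h2 : (B - 1 - x % B) / H = 0 := Nat.div_eq_of_lt (by omega)
    rw [h2] at h'
    have := Nat.div_pos hwH' hHpos
    omega

end Mirror

/-! #### Blocked vertices, the good sets `G o d` (level `2L - d`), and the counting -/

section Count

variable {L T κ : ℕ} {E : Finset (ℕ × ℕ)} (D : ChargedDB L T κ E) (J : Finset ℕ)

/-- K\*\* cone (auxiliary lemma): `unblocked_iff`. -/
theorem unblocked_iff {lam z : ℕ} : ¬ blocked D J lam z ↔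
    D.β lam z ∉ J ∧ ∀ t ∈ D.carrier lam z, t ∉ J := by
  unfold blocked
  rw [not_or, Finset.not_nonempty_iff_eq_empty, Finset.eq_empty_iff_forall_notMem]
  simp only [Finset.mem_inter, not_and]

/-- Fibre decomposition of a filtered product over `range`. -/
theorem card_filter_product_range {a : ℕ} {t : Finset ℕ} (P : ℕ × ℕ → Prop) [DecidablePred P] :
    (((range a) ×ˢ t).filter P).card = ∑ x ∈ range a, (t.filter (fun y => P (x, y))).card := by
  rw [card_filter, sum_product]
  refine sum_congr rfl (fun x _ => ?_)
  rw [card_filter]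

/-- K\*\* cone (auxiliary lemma): `card_Bltot_eq`. -/
theorem card_Bltot_eq : (Bltot D J).card = ∑ lam ∈ range (2 * L + 1), (Bl D J lam).card := by
  unfold Bltot Bl
  exact card_filter_product_range _

end Count

end KSSCount

end Summit.PneNP.PneNP.Theorems.RootDecompSegregatorSmallSegregators.Negative
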